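import Summits.CriticalPhenomena.Ising3DConformalLimit.Theses.FKParityRobustness
import Summits.CriticalPhenomena.Ising3DConformalLimit.Theorems.IndependentStrandsJoin.Negative.GraphUniform
import HarnessLib

/-!
# Strategy census — typed signatures (crux `IndependentStrandsJoin`, stmt-CriticalPhenomena-14625)

Companion of `Cruxes/IndependentStrandsJoin/STRATEGY-CENSUS.md` (crux-strategist
`planner-cstrat-stmt-CriticalPhenomena-14625-0`, 2026-08-16).  This file only DECLARES the statements the
census discusses (strengthenings `S2`–`S5`, the Paley–Zygmund split `D1a/D1b`, the glue `D1glue`), so that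
"stated as a signature" in the census means an elaborated `Prop` over the tree vocabulary.  Nothing here is
claimed true; the docstrings record the census verdict.  No `sorry`, no theorem.

Vocabulary: `G_N = (zdGraph 3).comap Subtype.val` on `↥(box 3 N)`, `t_c = tanh β_c(3)`,
`𝒯(S) = tJoins G_N univ S`, `Z(S) = loopO1PartitionFunction G_N t S`, `a = l • tetra` the regular
tetrahedron of the crux, `K_x(F)` = the `F`-component of `x` (spelled with `SimpleGraph.Reachable`).
-/

noncomputable section

open Finset
open Literature.Probability.LatticeModels
open Summit.CriticalPhenomena.Ising3DConformalLimit.Theses.FKParityRobustness (IndependentStrandsJoin)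

namespace Summit.CriticalPhenomena.Ising3DConformalLimit.Cruxes.IndependentStrandsJoin.Strategy

open scoped Classical

/-- The tetrahedral shape of the crux. -/
def tetra : Fin 4 → Site 3 := ![![-1, -1, -1], ![1, 1, -1], ![1, -1, 1], ![-1, 1, 1]]

section General

variable {V : Type*} [Fintype V] [DecidableEq V] (G : SimpleGraph V) [DecidableRel G.Adj]

/-- The crux's joint sum at parameter `t`: `Σ_{F₁ ∈ 𝒯(a₀a₁)} Σ_{F₂ ∈ 𝒯(a₂a₃)} t^{|F₁|+|F₂|} 1[a₀ ↔ a₂ in F₁ ∪ F₂]`. -/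
def jointSum (t : ℝ) (a : Fin 4 → V) : ℝ :=
  ∑ F₁ ∈ tJoins G Set.univ {a 0, a 1}, ∑ F₂ ∈ tJoins G Set.univ {a 2, a 3},
    if (SimpleGraph.fromEdgeSet ((↑F₁ : Set (Sym2 V)) ∪ ↑F₂)).Reachable (a 0) (a 2)
      then t ^ (F₁.card + F₂.card) else 0

/-- One-point MASS of the source cluster: `Σ_{F ∈ 𝒯(xy)} t^{|F|} 1[u ∈ V(K_x(F))]` (`= Z(xy) · ℓ^{xy}[u ∈ V(K_x)]`). -/
def massOne (t : ℝ) (x y u : V) : ℝ :=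
  ∑ F ∈ tJoins G Set.univ {x, y},
    if (SimpleGraph.fromEdgeSet (↑F : Set (Sym2 V))).Reachable x u then t ^ F.card else 0

/-- Two-point MASS of the source cluster: `Σ_{F ∈ 𝒯(xy)} t^{|F|} 1[u, v ∈ V(K_x(F))]`. -/
def massTwo (t : ℝ) (x y u v : V) : ℝ :=
  ∑ F ∈ tJoins G Set.univ {x, y},
    if (SimpleGraph.fromEdgeSet (↑F : Set (Sym2 V))).Reachable x u ∧
        (SimpleGraph.fromEdgeSet (↑F : Set (Sym2 V))).Reachable x v then t ^ F.card else 0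

end General

/-! ## § Strengthen -/

/-- **S1 (refuted in tree).**  The graph-uniform strengthening is FALSE:
`Theorems/IndependentStrandsJoin/Negative/GraphUniform.lean`, `not_graphUniformStrandsJoin` (path `0–1–2–3`).
Recorded here only by reference. -/
def S1_pointer : Prop := True

/-- **S2 — subcritical-uniform strengthening (census: FALSE, so no rigidity to borrow).**
One constant for every parameter `t ∈ (0, t_c]`.  For `t < t_c` the sourced loop-O(1) strands are
Ornstein–Zernike tubes of width `≍ √l` around the two skew edges of the tetrahedron, which are at mutual
distance `2l`, so `jointSum/(Z·Z) ≤ exp(-c(t)·l)` (sharpness of the Ising transition + OZ; Disproof § D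
regime scan).  Hence the crux cannot be the `t ↑ t_c` endpoint of a `t`-uniform high-temperature argument. -/
def S2_SubcriticalUniformStrandsJoin : Prop :=
  ∃ c : ℝ, 0 < c ∧ ∀ t : ℝ, 0 < t → t ≤ Real.tanh (criticalBeta 3) → ∀ l : ℕ, 1 ≤ l → ∃ N₀ : ℕ, ∀ N : ℕ, N₀ ≤ N →
    ∀ a : Fin 4 → ↥(box 3 N), (∀ i, ((a i : Site 3)) = (l : ℤ) • tetra i) →
      c * loopO1PartitionFunction ((zdGraph 3).comap (Subtype.val : ↥(box 3 N) → Site 3)) t {a 0, a 1} *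
          loopO1PartitionFunction ((zdGraph 3).comap (Subtype.val : ↥(box 3 N) → Site 3)) t {a 2, a 3}
        ≤ jointSum ((zdGraph 3).comap (Subtype.val : ↥(box 3 N) → Site 3)) t a

/-- **S3 — all-shapes strengthening (census: more general, not more rigid).**
Tetrahedral non-Gaussianity for EVERY injective lattice shape `x`, uniformly in the dilation `L`
(the crux is, by the kernel-checked sandwich `2q ≤ -U₄/G² ≤ 3q`, the case `x = tetra`).  It would be the
natural induction hypothesis of a multi-scale argument, but the induction STEP (gluing / separation of
meeting points from scale `L` to `2L`) is an RSW-class statement with no `d = 3` instance; so the extra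
generality buys no usable rigidity. -/
def S3_AllShapesU4Lattice : Prop :=
  ∀ x : Fin 4 → Site 3, Function.Injective x → ∃ c : ℝ, 0 < c ∧ ∀ L : ℕ, 1 ≤ L →
    criticalCorr 3 4 (fun i => (L : ℤ) • x i)
      - (criticalCorr 3 2 ![(L : ℤ) • x 0, (L : ℤ) • x 1] * criticalCorr 3 2 ![(L : ℤ) • x 2, (L : ℤ) • x 3]
        + criticalCorr 3 2 ![(L : ℤ) • x 0, (L : ℤ) • x 2] * criticalCorr 3 2 ![(L : ℤ) • x 1, (L : ℤ) • x 3]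
        + criticalCorr 3 2 ![(L : ℤ) • x 0, (L : ℤ) • x 3] * criticalCorr 3 2 ![(L : ℤ) • x 1, (L : ℤ) • x 2])
      ≤ -(c * (criticalCorr 3 2 ![(L : ℤ) • x 0, (L : ℤ) • x 1] * criticalCorr 3 2 ![(L : ℤ) • x 2, (L : ℤ) • x 3]))

/-- **S4 — deterministic-path shadow strengthening (census: PREDICTED FALSE; the true version needs fatness).**
"The `a₀`-cluster of EVERY `T`-join `D` of `{a₀,a₁}` casts a uniform shadow on `⟨σ_{a₂}σ_{a₃}⟩`."  It implies
`StrandShadow` (hence the crux, glue `ShadowGivesJoin`) trivially, but a straight lattice path is a defect of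
dimension `1 < Δ_ε = 1.4126`, IRRELEVANT for the `σσ` channel: its shadow tends to `0` as `l → ∞`.  The only
deterministic content of the random cluster `K_{a₀}(F)` is such a connected set of diameter `≍ l`; every
deterministic-set shadow statement therefore either is false (thin sets) or does not apply to `K` without a
fatness input (`StrandMass`, `D_HT > Δ_ε`) — which is the open half. -/
def S4_PathShadowUniform : Prop :=
  ∃ c : ℝ, 0 < c ∧ ∀ l : ℕ, 1 ≤ l → ∃ N₀ : ℕ, ∀ N : ℕ, N₀ ≤ N →
    ∀ a : Fin 4 → ↥(box 3 N), (∀ i, ((a i : Site 3)) = (l : ℤ) • tetra i) →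
      ∀ D ∈ tJoins ((zdGraph 3).comap (Subtype.val : ↥(box 3 N) → Site 3)) Set.univ {a 0, a 1},
        ¬ (SimpleGraph.fromEdgeSet (↑D : Set (Sym2 ↥(box 3 N)))).Reachable (a 0) (a 2) →
        ¬ (SimpleGraph.fromEdgeSet (↑D : Set (Sym2 ↥(box 3 N)))).Reachable (a 0) (a 3) →
        isingCorr ((zdGraph 3).comap (Subtype.val : ↥(box 3 N) → Site 3))
            (Finset.univ.filter (fun v : ↥(box 3 N) =>
              ¬ (SimpleGraph.fromEdgeSet (↑D : Set (Sym2 ↥(box 3 N)))).Reachable (a 0) v))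
            (criticalBeta 3) 0 .free {a 2, a 3}
          ≤ (1 - c) * isingCorr ((zdGraph 3).comap (Subtype.val : ↥(box 3 N) → Site 3))
              Finset.univ (criticalBeta 3) 0 .free {a 2, a 3}

/-- **S5 — matched second-moment strengthening (census: STRONGER, NOT EASIER).**
`E[N²] ≤ C·(E N)²` for `N = |V(K_{a₀}(F₁)) ∩ V(K_{a₂}(F₂))|` under `ℓ^{a₀a₁} ⊗ ℓ^{a₂a₃}`, with cleared
denominators (`E N · Z₀₁Z₂₃ = Σ_u m₀₁(u)m₂₃(u)`, `E N² · Z₀₁Z₂₃ = Σ_{u,v} m₀₁(u,v)m₂₃(u,v)`).  By Paley–Zygmund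
it implies the crux with `c = 1/C` (`D1glue`, provable now); it is the factorising sufficient condition whose
two halves are `D1a`/`D1b`.  Lead c1-0's verdict (E1/E2): every cluster that is a function of ONE replica is
thin (`D_HT ≈ 1.74`), so this needs strand quasi-multiplicativity with NO switching partner — no tool. -/
def S5_SecondMomentRatio : Prop :=
  ∃ C : ℝ, 0 < C ∧ ∀ l : ℕ, 1 ≤ l → ∃ N₀ : ℕ, ∀ N : ℕ, N₀ ≤ N →
    ∀ a : Fin 4 → ↥(box 3 N), (∀ i, ((a i : Site 3)) = (l : ℤ) • tetra i) →
      (let G := ((zdGraph 3).comap (Subtype.val : ↥(box 3 N) → Site 3))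
       let t : ℝ := Real.tanh (criticalBeta 3)
       loopO1PartitionFunction G t {a 0, a 1} * loopO1PartitionFunction G t {a 2, a 3} *
           ∑ u : ↥(box 3 N), ∑ v : ↥(box 3 N), massTwo G t (a 0) (a 1) u v * massTwo G t (a 2) (a 3) u v
         ≤ C * (∑ u : ↥(box 3 N), massOne G t (a 0) (a 1) u * massOne G t (a 2) (a 3) u) ^ 2)

/-! ## § Decomposition — the Paley–Zygmund split with a shared exponent `D` -/

/-- **D1a — strand density LOWER bound with exponent `D` (central window `‖u‖_∞ ≤ l/2`).**
`ℓ^{a₀a₁}[u ∈ V(K_{a₀})] ≥ c·l^{D-3}`, i.e. `massOne ≥ c l^{D-3} Z₀₁`.  The judge's "what would move it" is any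
`D > 3/2` here (even `E|V(K) ∩ B_l| ≥ l^{3/2+δ}`); the only rigorous floor is the `ε`-minorant
`ℓ^{xy}[e ∈ K] ≥ (t/(1-t²))⟨σ_xσ_y;σ_e⟩/⟨σ_xσ_y⟩` (card `epsilon-minorant`), whose right side has no floor
beyond GKS `≥ 0` at `β_c(3)` (`ν < 2/3` in disguise). -/
def D1a_StrandDensityLower (D : ℝ) : Prop :=
  ∃ c : ℝ, 0 < c ∧ ∀ l : ℕ, 1 ≤ l → ∃ N₀ : ℕ, ∀ N : ℕ, N₀ ≤ N →
    ∀ a : Fin 4 → ↥(box 3 N), (∀ i, ((a i : Site 3)) = (l : ℤ) • tetra i) →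
      ∀ u : ↥(box 3 N), (∀ i, 2 * |(u : Site 3) i| ≤ (l : ℤ)) →
        c * (l : ℝ) ^ (D - 3) *
            loopO1PartitionFunction ((zdGraph 3).comap (Subtype.val : ↥(box 3 N) → Site 3))
              (Real.tanh (criticalBeta 3)) {a 0, a 1}
          ≤ massOne ((zdGraph 3).comap (Subtype.val : ↥(box 3 N) → Site 3))
              (Real.tanh (criticalBeta 3)) (a 0) (a 1) u

/-- **D1b — strand pair UPPER bound at the matched exponent `D` (summed, tetrahedral window).**
`Σ_{u,v} m₀₁(u,v) m₂₃(u,v) ≤ C · l^{2(2D-3)} · Z₀₁ Z₂₃` — the second moment of the overlap count at the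
scale predicted by `D`.  The available ceiling is at the WRONG exponent: `m(u,v) ≤` (double-current tree
bound, dimension `2-η`, landed p99258), which overshoots `(E N)²` by `l^{2((2-η)-D_HT)} = l^{0.46}`. -/
def D1b_StrandPairUpper (D : ℝ) : Prop :=
  ∃ C : ℝ, 0 < C ∧ ∀ l : ℕ, 1 ≤ l → ∃ N₀ : ℕ, ∀ N : ℕ, N₀ ≤ N →
    ∀ a : Fin 4 → ↥(box 3 N), (∀ i, ((a i : Site 3)) = (l : ℤ) • tetra i) →
      (let G := ((zdGraph 3).comap (Subtype.val : ↥(box 3 N) → Site 3))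
       let t : ℝ := Real.tanh (criticalBeta 3)
       ∑ u : ↥(box 3 N), ∑ v : ↥(box 3 N), massTwo G t (a 0) (a 1) u v * massTwo G t (a 2) (a 3) u v
         ≤ C * (l : ℝ) ^ (2 * (2 * D - 3)) *
             (loopO1PartitionFunction G t {a 0, a 1} * loopO1PartitionFunction G t {a 2, a 3}))

/-- **D1 — the split as ONE item (census: the shared `∃ D > 3/2` makes it a single statement; `D1b`-type
control at matched scale already implies the crux, so `D1a` is not an independent piece).** -/
def D1_PaleyZygmundSplit : Prop :=
  ∃ D : ℝ, 3 / 2 < D ∧ D1a_StrandDensityLower D ∧ D1b_StrandPairUpper D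

/-- **D1glue — provable now (finite Cauchy–Schwarz: `jointSum ≥ Σ 1[K₁ ∩ K₂ ≠ ∅] ≥ (Σ_u m m)²/Σ_{u,v} m₂ m₂`;
pattern of the landed p106291 / `cross_fattening_decoupling` composition).  Not landed by this seat: with
`S5`/`D1` toolless it would glue nothing. -/
def D1glue : Prop := S5_SecondMomentRatio → IndependentStrandsJoin

end Summit.CriticalPhenomena.Ising3DConformalLimit.Cruxes.IndependentStrandsJoin.Strategy
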